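import Literature.ComputerArithmetic.Shewchuk1997.Compress
import Mathlib.Tactic.Linarith
import Mathlib.Tactic.Positivity
import Mathlib.Tactic.Ring
import Mathlib.Tactic.NormNum

/-!
# The fixed points of COMPRESS are chains (new work)

New work of the certified-arithmetic venture (ENGINES group: shared numerical engines serving
client cells; rigour lives in the verifiers; every published number belongs to a client cell's
ledger, not to the engines group).

For COMPRESS [Shewchuk1997, §2.7 Theorem 23] under ANY round-to-nearest `fl` (`p ≥ 2`, gradual
underflow), call a list `⟨e₁, …, eₙ⟩` a CHAIN when every component is a nonzero float absorbed by
the next one: `fl(eᵢ₊₁ + eᵢ) = eᵢ₊₁`, `eᵢ ≠ 0` (the predicate of `CompressStaircaseFixedPoint`,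
where chains were shown to be fixed points of COMPRESS).  THIS FILE proves the converse: a
nonoverlapping expansion of floats that COMPRESS leaves unchanged IS a chain
(`isChain_of_compress_eq_self`).  So the fixed points of COMPRESS — equivalently, the outputs on
which a second pass changes nothing — are exactly the chains; e.g. the three-component output `⟨−1,
−(2^p − 4), −(2^p−1)·2^(p+1)⟩` of `CompressNotIdempotent` is not one (`−(2^p − 4) + (−1)` is a
float), which is why a second pass shortens it.

Proof (induction on the length, peeling the top pair `b, c` of `e = l ++ ⟨b, c⟩`): COMPRESS never
lengthens a list (`compress_length_le`), so at a fixed point every FAST-TWO-SUM of both traversals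
emits; the upward traversal of `e` is that of the shorter valid expansion `l ++ ⟨q⟩`,
`q = c + b − fl(c + b)` (`isExpansion_init_roundoff`), followed by one more step
(`compressUp_append_singleton`); comparing the two outputs componentwise and using the exact sum of
Theorem 23 (`compress_sum`) on `l ++ ⟨q⟩` forces `fl(c + b) = c`, `q = b`, and `l ++ ⟨b⟩` fixed.
HONEST FRAMING: a structural fact about the printed algorithm, not a claim of the paper.
-/

namespace Summit.Ventures.CertifiedArithmetic.Expansions

open Literature.ComputerArithmetic.JeannerodRump2018
open Literature.ComputerArithmetic.BoldoJeannerodMelquiondMuller2023 hiding twoSum twoSum_fst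
open Literature.ComputerArithmetic.Shewchuk1997

variable {p : ℕ} {emin : ℤ}

/-! ### COMPRESS never lengthens (any `fl`) -/

/-- The downward traversal emits at most one `g` per input component.
[cite: Shewchuk1997, Thm 23 p. 331] -/
private theorem compressDown_length_le (fl : ℚ → ℚ) :
    ∀ (xs : List ℚ) (Q : ℚ), (compressDown fl Q xs).1.length ≤ xs.length
  | [], Q => by simp
  | x :: xs, Q => by
    by_cases h : (fastTwoSum fl Q x).2 = 0
    · rw [compressDown_cons_of_eq_zero h]
      exact (compressDown_length_le fl xs _).trans (Nat.le_succ _)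
    · rw [compressDown_cons_of_ne_zero h]
      simpa using compressDown_length_le fl xs _

/-- The upward traversal emits at most one `h` per `g`, plus the final carry.
[cite: Shewchuk1997, Thm 23 p. 331] -/
private theorem compressUp_length_le (fl : ℚ → ℚ) :
    ∀ (gs : List ℚ) (Q : ℚ), (compressUp fl Q gs).length ≤ gs.length + 1
  | [], Q => by simp
  | g :: gs, Q => by
    by_cases h : (fastTwoSum fl g Q).2 = 0
    · rw [compressUp_cons_of_eq_zero h]
      exact (compressUp_length_le fl gs _).trans (by simp)
    · rw [compressUp_cons_of_ne_zero h]
      simpa using compressUp_length_le fl gs _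

/-- "If round-to-even tiebreaking is used, `h` contains no more than `n` components" holds for the
LENGTH under any `fl` whatsoever: COMPRESS never lengthens a list.
[cite: Shewchuk1997, Thm 23 p. 331] -/
theorem compress_length_le (fl : ℚ → ℚ) (e : List ℚ) : (compress fl e).length ≤ e.length := by
  cases hrev : e.reverse with
  | nil =>
    have he : e = [] := by simpa using congrArg List.reverse hrev
    subst he
    simp [compress]
  | cons em rest =>
    have he : e = rest.reverse ++ [em] := by simpa using congrArg List.reverse hrev
    simp only [compress, hrev]
    calc (compressUp fl (compressDown fl em rest).2 (compressDown fl em rest).1.reverse).length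
        ≤ (compressDown fl em rest).1.reverse.length + 1 := compressUp_length_le fl _ _
      _ ≤ rest.length + 1 := by
          rw [List.length_reverse]; exact Nat.succ_le_succ (compressDown_length_le fl rest em)
      _ = e.length := by rw [he]; simp

/-! ### Peeling the top of the two traversals -/

/-- COMPRESS of a list presented with its top component last. [cite: Shewchuk1997, §2.7 p. 332] -/
theorem compress_concat (fl : ℚ → ℚ) (l : List ℚ) (x : ℚ) :
    compress fl (l ++ [x]) =
      compressUp fl (compressDown fl x l.reverse).2 (compressDown fl x l.reverse).1.reverse := by
  have hrev : (l ++ [x]).reverse = x :: l.reverse := by simp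
  simp only [compress, hrev]

/-- The upward traversal with one more `g` on top: the previous output minus its top `T`, followed
by the emit/absorb of `FAST-TWO-SUM(g, T)`. [cite: Shewchuk1997, §2.7 p. 332, Lines 10–16] -/
theorem compressUp_append_singleton (fl : ℚ → ℚ) :
    ∀ (xs : List ℚ) (Q g : ℚ), ∃ ys : List ℚ, ∃ T : ℚ, compressUp fl Q xs = ys ++ [T] ∧
      compressUp fl Q (xs ++ [g]) = ys ++
        (if (fastTwoSum fl g T).2 = 0 then [(fastTwoSum fl g T).1]
          else [(fastTwoSum fl g T).2, (fastTwoSum fl g T).1])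
  | [], Q, g => by
    refine ⟨[], Q, by simp, ?_⟩
    by_cases h : (fastTwoSum fl g Q).2 = 0
    · rw [List.nil_append, compressUp_cons_of_eq_zero h, compressUp_nil, if_pos h, List.nil_append]
    · rw [List.nil_append, compressUp_cons_of_ne_zero h, compressUp_nil, if_neg h, List.nil_append]
  | x :: xs, Q, g => by
    obtain ⟨ys, T, h1, h2⟩ := compressUp_append_singleton fl xs (fastTwoSum fl x Q).1 g
    by_cases h : (fastTwoSum fl x Q).2 = 0
    · exact ⟨ys, T, by rw [compressUp_cons_of_eq_zero h, h1],
        by rw [List.cons_append, compressUp_cons_of_eq_zero h, h2]⟩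
    · exact ⟨(fastTwoSum fl x Q).2 :: ys, T,
        by rw [compressUp_cons_of_ne_zero h, h1, List.cons_append],
        by rw [List.cons_append, compressUp_cons_of_ne_zero h, h2, List.cons_append]⟩

/-- Peeling an ABSORBED top pair: if `FAST-TWO-SUM(c, b)` has zero roundoff, COMPRESS of
`l ++ ⟨b, c⟩` is COMPRESS of the shorter `l ++ ⟨fl(c + b)⟩`.
[cite: Shewchuk1997, §2.7 p. 332, Lines 1–9] -/
theorem compress_append_pair_of_eq_zero (fl : ℚ → ℚ) (l : List ℚ) {b c : ℚ}
    (h : (fastTwoSum fl c b).2 = 0) :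
    compress fl (l ++ [b, c]) = compress fl (l ++ [(fastTwoSum fl c b).1]) := by
  have hrev : (l ++ [b, c]).reverse = c :: b :: l.reverse := by simp
  rw [compress_concat fl l (fastTwoSum fl c b).1]
  simp only [compress, hrev]
  rw [compressDown_cons_of_eq_zero h]

/-- Peeling an EMITTING top pair: if `FAST-TWO-SUM(c, b) = (s, q)` with `q ≠ 0`, COMPRESS of
`l ++ ⟨b, c⟩` is COMPRESS of `l ++ ⟨q⟩` minus its top `T`, followed by the emit/absorb of
`FAST-TWO-SUM(s, T)`. [cite: Shewchuk1997, §2.7 p. 332] -/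
theorem compress_append_pair_of_ne_zero (fl : ℚ → ℚ) (l : List ℚ) {b c : ℚ}
    (h : (fastTwoSum fl c b).2 ≠ 0) :
    ∃ ys : List ℚ, ∃ T : ℚ, compress fl (l ++ [(fastTwoSum fl c b).2]) = ys ++ [T] ∧
      compress fl (l ++ [b, c]) = ys ++
        (if (fastTwoSum fl (fastTwoSum fl c b).1 T).2 = 0
          then [(fastTwoSum fl (fastTwoSum fl c b).1 T).1]
          else [(fastTwoSum fl (fastTwoSum fl c b).1 T).2,
            (fastTwoSum fl (fastTwoSum fl c b).1 T).1]) := by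
  have hrev : (l ++ [b, c]).reverse = c :: b :: l.reverse := by simp
  obtain ⟨ys, T, h1, h2⟩ := compressUp_append_singleton fl
    (compressDown fl (fastTwoSum fl c b).2 l.reverse).1.reverse
    (compressDown fl (fastTwoSum fl c b).2 l.reverse).2 (fastTwoSum fl c b).1
  refine ⟨ys, T, by rw [compress_concat, h1], ?_⟩
  simp only [compress, hrev]
  rw [compressDown_cons_of_ne_zero h, List.reverse_cons, h2]

/-! ### The shorter list is again a valid expansion -/

/-- Replacing the top pair `b, c` (`b ≠ 0`) of a nonoverlapping expansion by
the roundoff `q = c + b − fl(c + b)` keeps it a nonoverlapping expansion: `q` lies on every grid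
`2^s` that carries `b` and dominates a lower component, because `c` and `fl(c + b)` lie on it too.
[cite: Shewchuk1997, Thm 23 p. 333 (proof: "g_bottom and the g's are nonoverlapping")] -/
theorem isExpansion_init_roundoff {fl : ℚ → ℚ} (hp : 1 ≤ p) (hfl : IsRoundNearest p emin fl)
    {l : List ℚ} {b c : ℚ} (hb0 : b ≠ 0) (he : IsExpansion 1 (l ++ [b, c])) :
    IsExpansion 1 (l ++ [c + b - fl (c + b)]) := by
  obtain ⟨hl, hbc2, hlb⟩ := List.pairwise_append.mp he
  have hbc : Below 1 b c := (List.pairwise_cons.mp hbc2).1 c (by simp)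
  refine List.pairwise_append.mpr ⟨hl, List.pairwise_singleton _ _, fun x hx y hy => ?_⟩
  rw [List.mem_singleton] at hy
  subst hy
  obtain ⟨s, hsb, hxs⟩ := hlb x hx b (by simp)
  obtain ⟨s₂, hs2c, hbs2⟩ := hbc
  have h2s : (2 : ℚ) ^ s < 2 ^ s₂ := lt_of_le_of_lt (hsb.two_zpow_le_abs hb0) (by simpa using hbs2)
  have hss : s ≤ s₂ := ((zpow_lt_zpow_iff_right₀ (by norm_num : (1 : ℚ) < 2)).mp h2s).le
  have hsc : OnGrid s c := hs2c.mono hss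
  have hsum : OnGrid s (c + b) := hsc.add hsb
  have hsfl : OnGrid s (fl (c + b)) := by
    rcases le_or_gt emin s with h1 | h1
    · exact hsum.fl_of hp hfl h1
    · exact (OnGrid.of_isFloat (hfl _).1).mono h1.le
  exact ⟨s, hsum.sub hsfl, hxs⟩

/-! ### Fixed points are chains -/

/-- **The fixed points of COMPRESS are chains** (any round-to-nearest, `p ≥ 2`): if a nonoverlapping
expansion `e` of floats satisfies `COMPRESS(e) = e`, then each component is a nonzero float absorbed
by the next, `fl(eᵢ₊₁ + eᵢ) = eᵢ₊₁` (the converse is `compress_eq_self_of_isChain`).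
[cite: Shewchuk1997, Thm 23 p. 331–333; §2.3 Theorem 6] -/
theorem isChain_of_compress_eq_self {fl : ℚ → ℚ} (hp : 2 ≤ p) (hfl : IsRoundNearest p emin fl) :
    ∀ (n : ℕ) (e : List ℚ), e.length = n → (∀ x ∈ e, IsFloat p emin x) → IsExpansion 1 e →
      compress fl e = e → List.IsChain (fun a b => fl (b + a) = b ∧ fl a = a ∧ a ≠ 0) e := by
  have hp1 : 1 ≤ p := le_trans (by norm_num) hp
  intro n
  induction n with
  | zero =>
    intro e hlen _ _ _
    rw [List.length_eq_zero_iff.mp hlen]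
    exact List.isChain_nil
  | succ n ih =>
    intro e hlen hfloat hexp hfix
    -- present `e` top-last: `e = l ++ [b, c]`, or a singleton
    cases hrev : e.reverse with
    | nil =>
      have he : e = [] := by simpa using congrArg List.reverse hrev
      rw [he]; exact List.isChain_nil
    | cons c rest =>
      cases rest with
      | nil =>
        have he : e = [c] := by simpa using congrArg List.reverse hrev
        rw [he]; exact List.isChain_singleton c
      | cons b lrev =>
        have he : e = lrev.reverse ++ [b, c] := by simpa using congrArg List.reverse hrev
        set l := lrev.reverse with hl
        rw [he] at hlen hfloat hexp hfix ⊢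
        simp only [List.length_append, List.length_cons, List.length_nil] at hlen
        have hb : IsFloat p emin b := hfloat b (by simp)
        have hc : IsFloat p emin c := hfloat c (by simp)
        have hlfl : ∀ x ∈ l, IsFloat p emin x := fun x hx => hfloat x (by simp [hx])
        -- a fixed point cannot come from a shorter list
        have hshort : ∀ y : ℚ, compress fl (l ++ [b, c]) ≠ compress fl (l ++ [y]) := by
          intro y hy
          have h1 := compress_length_le fl (l ++ [y])
          rw [← hy, hfix] at h1
          simp at h1
        -- the top pair emits: `c ≠ 0`, `q ≠ 0`, `b ≠ 0`
        have hc0 : c ≠ 0 := by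
          rintro rfl
          have hF : fastTwoSum fl 0 b = (b, 0) := fastTwoSum_zero_left hfl hb
          exact hshort _ (compress_append_pair_of_eq_zero fl l (b := b) (c := 0) (by rw [hF]))
        have hbc : Below 1 b c := by
          have := hexp; simp only [IsExpansion, List.pairwise_append, List.pairwise_cons,
            List.mem_cons, List.not_mem_nil, or_false, forall_eq] at this
          exact this.2.1.1
        have hbc' : |b| ≤ |c| := (hbc.abs_lt le_rfl hc0).le
        obtain ⟨hs1, -, hq1, hsum1⟩ := fastTwoSum_exact hp1 hfl hc hb hbc'
        have hq0 : (fastTwoSum fl c b).2 ≠ 0 := fun h0 =>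
          hshort _ (compress_append_pair_of_eq_zero fl l h0)
        have hb0 : b ≠ 0 := by
          rintro rfl
          rw [hq1, add_zero, fl_eq_self hfl hc, sub_self] at hq0
          exact hq0 rfl
        -- the shorter valid expansion `l ++ [q]`
        have hqfl : IsFloat p emin (fastTwoSum fl c b).2 := (isFloat_fastTwoSum hfl c b).2
        have hval : ∀ x ∈ l ++ [(fastTwoSum fl c b).2], IsFloat p emin x := by
          intro x hx
          rw [List.mem_append, List.mem_singleton] at hx
          rcases hx with hx | rfl
          exacts [hlfl x hx, hqfl]
        have hexp' : IsExpansion 1 (l ++ [(fastTwoSum fl c b).2]) := by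
          rw [hq1]; exact isExpansion_init_roundoff hp1 hfl hb0 hexp
        -- peel the emitting top and compare with `e`
        obtain ⟨ys, T, hys, hdec⟩ := compress_append_pair_of_ne_zero fl l hq0
        have hlen' := compress_length_le fl (l ++ [(fastTwoSum fl c b).2])
        rw [hys] at hlen'
        simp only [List.length_append, List.length_cons, List.length_nil] at hlen'
        by_cases hr : (fastTwoSum fl (fastTwoSum fl c b).1 T).2 = 0
        · -- last step absorbs: output too short
          rw [if_pos hr, hfix] at hdec
          have := congrArg List.length hdec
          simp at this
          omega
        · rw [if_neg hr, hfix] at hdec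
          obtain ⟨hysl, hpair⟩ := List.append_inj' hdec.symm rfl
          simp only [List.cons.injEq, and_true] at hpair
          obtain ⟨hrb, hSc⟩ := hpair
          -- exact sum of Theorem 23 on the shorter list identifies its top: `T = q`
          have hsum := compress_sum hp hfl hval hexp'
          rw [hys, hysl, List.sum_append, List.sum_append, List.sum_singleton,
            List.sum_singleton] at hsum
          have hT : T = (fastTwoSum fl c b).2 := add_left_cancel hsum
          -- hence `fl(c + b) = c`, `q = b`, and `l ++ [b]` is a fixed point
          have hS : (fastTwoSum fl (fastTwoSum fl c b).1 T).1 = (fastTwoSum fl c b).1 := by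
            show fl ((fastTwoSum fl c b).1 + T) = _
            rw [hT, hsum1, hs1]
          have hcb : fl (c + b) = c := by rw [← hs1, ← hS, hSc]
          have hqb : (fastTwoSum fl c b).2 = b := by rw [hq1, hcb]; ring
          have hfix' : compress fl (l ++ [b]) = l ++ [b] := by
            rw [← hqb, hys, hysl, hT]
          have hexpb : IsExpansion 1 (l ++ [b]) := by rw [← hqb]; exact hexp'
          have hflb : ∀ x ∈ l ++ [b], IsFloat p emin x := by rw [← hqb]; exact hval
          have ihb := ih (l ++ [b])
            (by simp only [List.length_append, List.length_cons, List.length_nil]; omega)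
            hflb hexpb hfix'
          exact List.isChain_append_cons_cons.mpr
            ⟨ihb, ⟨hcb, fl_eq_self hfl hb, hb0⟩, List.isChain_singleton c⟩

/-- The same, packaged: a valid expansion fixed by COMPRESS is a chain.
[cite: Shewchuk1997, Thm 23 p. 331] -/
theorem compress_fixed_isChain {fl : ℚ → ℚ} (hp : 2 ≤ p) (hfl : IsRoundNearest p emin fl)
    {e : List ℚ} (he : ∀ x ∈ e, IsFloat p emin x) (hexp : IsExpansion 1 e)
    (hfix : compress fl e = e) : List.IsChain (fun a b => fl (b + a) = b ∧ fl a = a ∧ a ≠ 0) e :=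
  isChain_of_compress_eq_self hp hfl e.length e rfl he hexp hfix

/-- Consequently every component of a fixed point is nonzero and adjacent components are ABSORBED,
`fl(eᵢ₊₁ + eᵢ) = eᵢ₊₁` — the hypothesis under which `CompressRelativeErrorTwoTerm` proves the
relative reading pairwise. [cite: Shewchuk1997, Thm 23 p. 331; §2.7 p. 333] -/
theorem compress_fixed_pairs_absorbed {fl : ℚ → ℚ} (hp : 2 ≤ p) (hfl : IsRoundNearest p emin fl)
    {l : List ℚ} {a b : ℚ} {r : List ℚ} (he : ∀ x ∈ l ++ a :: b :: r, IsFloat p emin x)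
    (hexp : IsExpansion 1 (l ++ a :: b :: r))
    (hfix : compress fl (l ++ a :: b :: r) = l ++ a :: b :: r) :
    fl (b + a) = b ∧ a ≠ 0 := by
  have h := List.isChain_append_cons_cons.mp (compress_fixed_isChain hp hfl he hexp hfix)
  exact ⟨h.2.1.1, h.2.1.2.2⟩

/-- SANITY CHECK (`p = 3`, `emin = 0`, round-to-even; an evaluation): the output `⟨−1, −4, −112⟩`
of `CompressNotIdempotent` is NOT a chain — `fl(−4 + (−1)) = −5 ≠ −4` — consistent with its
second pass being shorter. [cite: Shewchuk1997, §2.7 p. 332] -/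
example : ¬ List.IsChain (fun a b => roundTiesEven 3 0 (b + a) = b ∧ roundTiesEven 3 0 a = a ∧
    a ≠ 0) [-1, -4, -112] := by
  intro h
  have h1 := (List.isChain_cons_cons.mp h).1.1
  have hf : IsFloat 3 0 (-5) := ⟨-5, 0, by norm_num, le_rfl, by norm_num⟩
  rw [show (-4 : ℚ) + -1 = -5 by norm_num, roundTiesEven_eq_self (by norm_num) hf] at h1
  norm_num at h1

end Summit.Ventures.CertifiedArithmetic.Expansions
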